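import Literature.Analysis.FunctionSpaces.SpaceTimeLipschitz
import Literature.Analysis.FunctionSpaces.TorusSpaceTime
import HarnessLib

/-!
# K2R transfer bound I: uniform Lipschitz bounds of jointly smooth fields and of their gradients

Route `EnskogAdjointDuality` of `AtomisticToContinuum/HydrodynamicLimit`, crux `AdjointEnskogTestFamilyR`
(stmt-AtomisticToContinuum-11592, "K2R"), line `birth`, stub `stub_transferBound` (G3b), helper I (generic
space–time calculus on the flat torus `𝕋³`):

* `k2r_tb_isSmoothSpaceTimeOn_comp` — post-composition of a jointly smooth scalar field with a function
  smooth on a set containing its values is jointly smooth;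
* `k2r_tb_exists_lipschitz_slice` — a field jointly smooth on `[0,t] × 𝕋³` (`t > 0`) is bounded there and
  Lipschitz in space, uniformly in time (bounded partial derivatives on the compact window +
  `Torus.lipschitzWith_of_norm_partialDeriv_le`);
* `k2r_tb_gradient_apply` — `(∇g(x))ᵢ = ∂ᵢ g(x)` for `C¹` scalar `g`;
* `k2r_tb_exists_gradient_bounds` — for a scalar field jointly smooth on `[0,t] × 𝕋³`: smooth slices,
  and ONE constant bounding `|W|`, `‖∇W‖`, `|∂ᵢW|` and the Lipschitz constant of `∇W(s,·)`, uniformly in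
  `s ∈ [0,t]` (the registered sub-goal `stub_transferBound_lipschitz`).

References: L. C. Evans, *Partial Differential Equations* (2010), App. C.2 [Evans2010] (calculus facts);
C. De Lellis, H. Kwon, Anal. PDE 15 (2022), §2.2 [DelellisKwon2022] (space–time Lipschitz from `C¹` bounds).
-/

noncomputable section

open Set Filter Topology Function
open scoped InnerProductSpace BigOperators ContDiff NNReal

namespace Summit.AtomisticToContinuum.HydrodynamicLimit.Theorems.EnskogAdjointDuality

open Literature.Analysis.FunctionSpaces

variable {F : Type*} [NormedAddCommGroup F] [NormedSpace ℝ F]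

/-- Post-composition of a jointly smooth scalar field with a function smooth on a set containing all its
values is jointly smooth. [folklore] -/
theorem k2r_tb_isSmoothSpaceTimeOn_comp {S : Set ℝ} {ρ : ℝ → UnitAddTorus (Fin 3) → ℝ}
    (hρ : Torus.IsSmoothSpaceTimeOn S ρ) {Y : ℝ → ℝ} {V : Set ℝ} (hY : ContDiffOn ℝ ∞ Y V)
    (hmaps : ∀ s ∈ S, ∀ x, ρ s x ∈ V) : Torus.IsSmoothSpaceTimeOn S (fun s x => Y (ρ s x)) := by
  have h : Torus.stLift (fun s x => Y (ρ s x)) = Y ∘ Torus.stLift ρ := by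
    funext p; rfl
  unfold Torus.IsSmoothSpaceTimeOn
  rw [h]
  exact hY.comp hρ fun p hp => hmaps p.1 (mem_prod.1 hp).1 _

/-- **Uniform bounds and spatial Lipschitz constants on a compact window.** A field jointly smooth on
`[0,t] × 𝕋³` (`t > 0`) is bounded by some `L ≥ 0` and `L`-Lipschitz in space, uniformly in `s ∈ [0,t]`
(its partial derivatives are again jointly smooth, hence bounded on the compact window; then the mean
value inequality `Torus.lipschitzWith_of_norm_partialDeriv_le`). [cite: DelellisKwon2022, §2.2] -/
theorem k2r_tb_exists_lipschitz_slice {t : ℝ} (ht : 0 < t) {g : ℝ → UnitAddTorus (Fin 3) → F}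
    (hg : Torus.IsSmoothSpaceTimeOn (Icc 0 t) g) :
    ∃ L : ℝ, 0 ≤ L ∧ (∀ s ∈ Icc 0 t, ∀ x, ‖g s x‖ ≤ L) ∧
      ∀ s ∈ Icc 0 t, ∀ x x', ‖g s x - g s x'‖ ≤ L * dist x x' := by
  have hU : UniqueDiffOn ℝ (Icc 0 t) := uniqueDiffOn_Icc ht
  obtain ⟨B₀, hB₀⟩ := hg.exists_norm_le_of_isCompact isCompact_Icc Subset.rfl
  have hB : ∀ i : Fin 3, ∃ Bi : ℝ, ∀ s ∈ Icc 0 t, ∀ x, ‖Torus.partialDeriv i (g s) x‖ ≤ Bi :=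
    fun i => (hg.partialDeriv hU i).exists_norm_le_of_isCompact isCompact_Icc Subset.rfl
  choose Bp hBp using hB
  set M : Fin 3 → ℝ≥0 := fun i => Real.toNNReal (Bp i) with hM
  set K : ℝ≥0 := NNReal.sqrt (Fintype.card (Fin 3)) * ∑ i, M i with hK
  refine ⟨|B₀| + K, by positivity, fun s hs x => ?_, fun s hs x x' => ?_⟩
  · exact ((hB₀ s hs x).trans (le_abs_self _)).trans (le_add_of_nonneg_right K.2)
  · have hslice : Torus.IsContDiff 1 (g s) := (hg.isSmooth_slice hs).isContDiff (by simp)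
    have hLip : LipschitzWith K (g s) :=
      Torus.lipschitzWith_of_norm_partialDeriv_le hslice (M := M) fun i y =>
        (hBp i s hs y).trans (by rw [hM]; exact Real.le_coe_toNNReal (Bp i))
    have h := hLip.dist_le_mul x x'
    rw [dist_eq_norm] at h
    refine h.trans ?_
    have : (K : ℝ) ≤ |B₀| + K := le_add_of_nonneg_left (abs_nonneg _)
    exact mul_le_mul_of_nonneg_right this dist_nonneg

/-- The components of the gradient are the partial derivatives: `(∇g(x))ᵢ = ∂ᵢg(x)` for `C¹` `g`.
[folklore] -/
theorem k2r_tb_gradient_apply {g : UnitAddTorus (Fin 3) → ℝ} (hg : Torus.IsContDiff 1 g)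
    (x : UnitAddTorus (Fin 3)) (i : Fin 3) : Torus.gradient g x i = Torus.partialDeriv i g x := by
  rw [Torus.gradient_eq_sum_partialDeriv hg]
  simp [Finset.sum_apply, Pi.single_apply]

/-- The norm of a partial derivative is at most the norm of the gradient (`C¹` scalar functions).
[folklore] -/
theorem k2r_tb_abs_partialDeriv_le_norm_gradient {g : UnitAddTorus (Fin 3) → ℝ}
    (hg : Torus.IsContDiff 1 g) (x : UnitAddTorus (Fin 3)) (i : Fin 3) :
    |Torus.partialDeriv i g x| ≤ ‖Torus.gradient g x‖ := by
  rw [← k2r_tb_gradient_apply hg x i]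
  simpa using PiLp.norm_apply_le (Torus.gradient g x) i

/-- **Uniform gradient bounds of a jointly smooth scalar field on a compact window.** For `W` jointly
smooth on `[0,t] × 𝕋³` (`t > 0`): every slice `W(s,·)` is smooth, and one constant `K ≥ 0` bounds
`|W|`, `‖∇W‖`, `|∂ᵢW|` and the spatial Lipschitz constant of `∇W(s,·)`, uniformly in `s ∈ [0,t]`
(apply `k2r_tb_exists_lipschitz_slice` to `W` and to the jointly smooth field `∇W`).
[cite: DelellisKwon2022, §2.2] -/
theorem k2r_tb_exists_gradient_bounds {t : ℝ} (ht : 0 < t) {W : ℝ → UnitAddTorus (Fin 3) → ℝ}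
    (hW : Torus.IsSmoothSpaceTimeOn (Icc 0 t) W) :
    ∃ K : ℝ, 0 ≤ K ∧ (∀ s ∈ Icc 0 t, Torus.IsSmooth (W s)) ∧
      (∀ s ∈ Icc 0 t, ∀ x, |W s x| ≤ K) ∧
      (∀ s ∈ Icc 0 t, ∀ x, ‖Torus.gradient (W s) x‖ ≤ K) ∧
      (∀ s ∈ Icc 0 t, ∀ x, ∀ i : Fin 3, |Torus.partialDeriv i (W s) x| ≤ K) ∧
      (∀ s ∈ Icc 0 t, ∀ x x',
        ‖Torus.gradient (W s) x - Torus.gradient (W s) x'‖ ≤ K * dist x x') := by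
  have hU : UniqueDiffOn ℝ (Icc 0 t) := uniqueDiffOn_Icc ht
  obtain ⟨L₀, hL₀, hW₀, -⟩ := k2r_tb_exists_lipschitz_slice ht hW
  obtain ⟨L₁, hL₁, hG₀, hG₁⟩ := k2r_tb_exists_lipschitz_slice ht (hW.gradient hU)
  refine ⟨L₀ + L₁, by positivity, fun s hs => hW.isSmooth_slice hs, fun s hs x => ?_,
    fun s hs x => ?_, fun s hs x i => ?_, fun s hs x x' => ?_⟩
  · have h := hW₀ s hs x
    rw [Real.norm_eq_abs] at h
    linarith
  · linarith [hG₀ s hs x]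
  · have h1 := k2r_tb_abs_partialDeriv_le_norm_gradient
      ((hW.isSmooth_slice hs).isContDiff (by simp)) x i
    linarith [hG₀ s hs x]
  · exact (hG₁ s hs x x').trans (mul_le_mul_of_nonneg_right (by linarith) dist_nonneg)

/-- **Registered sub-goal `stub_transferBound_lipschitz`** (K2R line `birth`, stub G3b, helper I): uniform
gradient bounds of a jointly smooth scalar field on a compact window, as a closed statement
(`k2r_tb_exists_gradient_bounds`). [cite: DelellisKwon2022, §2.2] -/
theorem stub_transferBound_lipschitz :
    ∀ (t : ℝ), 0 < t → ∀ (W : ℝ → UnitAddTorus (Fin 3) → ℝ),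
    Literature.Analysis.FunctionSpaces.Torus.IsSmoothSpaceTimeOn (Set.Icc 0 t) W →
    ∃ K : ℝ, 0 ≤ K ∧ (∀ s ∈ Set.Icc 0 t, Literature.Analysis.FunctionSpaces.Torus.IsSmooth (W s)) ∧
      (∀ s ∈ Set.Icc 0 t, ∀ x, |W s x| ≤ K) ∧
      (∀ s ∈ Set.Icc 0 t, ∀ x, ‖Literature.Analysis.FunctionSpaces.Torus.gradient (W s) x‖ ≤ K) ∧
      (∀ s ∈ Set.Icc 0 t, ∀ x, ∀ i : Fin 3,
        |Literature.Analysis.FunctionSpaces.Torus.partialDeriv i (W s) x| ≤ K) ∧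
      (∀ s ∈ Set.Icc 0 t, ∀ x x',
        ‖Literature.Analysis.FunctionSpaces.Torus.gradient (W s) x -
          Literature.Analysis.FunctionSpaces.Torus.gradient (W s) x'‖ ≤ K * dist x x') :=
  fun _ ht _ hW => k2r_tb_exists_gradient_bounds ht hW

end Summit.AtomisticToContinuum.HydrodynamicLimit.Theorems.EnskogAdjointDuality

end
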